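import Mathlib
import Summits.NavierStokesRegularity.NavierStokesRegularity.Theorems.EulerZoomLiouvillePowerGaugeEulerLiouvilleClockTransferWeights
import Literature.Analysis.FluidPDE.ClassicalSuitable
import Literature.Analysis.FluidPDE.SelfSimilarEulerProfile
import HarnessLib

/-!
# PROFILE ⇒ MEMBER: a `C²` CIV profile pair with finite own-rate weights at infinity IS an exactly self-similar member of Seregin's class
# (crux `EulerZoomLiouville.PowerGaugeEulerLiouville` = stmt-NavierStokesRegularity-19832, line `birth`, THE ONE STATEMENT — refuter/planner interface)

Route `EulerZoomLiouville` (NavierStokesRegularity); width seat ns-ezl-w6 g2 (LEAD ns-typeII-p2 g12).  The lineage's dictionary is one-way so far: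
MEMBER ⇒ PROFILE (`profile_energy_growth_of_gaugeA`, `profile_gradient_weight_of_gaugeE`, `profile_pressure_weight_of_gaugeD`, `rungC1_of_profileLiouville_full`:
«to kill the members it suffices to kill the profiles»).  This file closes the loop for `C²` profiles: PROFILE ⇒ MEMBER.  Let `(V, P′)` solve CIV (3.3) on `ℝ³`
(`IsSelfSimilarEulerProfile γ 0 V P′`, `γ = 1/(2+ρ)`, `−1/2 < ρ < 1`; `V ∈ C²`, `P′ ∈ C¹`) and carry the three OWN-RATE WEIGHTS AT INFINITY
`∫_{B_L}‖V‖² ≤ N L^{1−2ρ}` (`L ≥ 1`), `∫_{‖y‖≥1}|∇V|²‖y‖^{ρ−1} < ∞`, `∫_{‖y‖≥1}|P′|^{3/2}‖y‖^{2ρ−2} < ∞`.  Then the ansatz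
`(selfSimilarCollapse γ 0 V, selfSimilarCollapsePressure γ 0 P′)` with the classical gradient `(t,x) ↦ D(selfSimilarCollapse γ 0 V t)(x)` is a member of the class with
exponent `ρ` (`ProfileMember.exists_inClass_of_profile`): suitable weak Euler pair on `(−∞,0) × ℝ³` (classical ⇒ suitable, tree `isSuitableWeakSolutionOn_of_contDiffOn`
with CIV's `euler_selfSimilarCollapse`; `ProfileMember.isSuitableWeakSolutionOn_selfSimilarCollapse`), weak gradient (`hasWeakSpatialGradientOn_of_contDiffOn`), and the
three gauges at ALL scales (small profile scales free from `C²`/`C¹`; reverse dictionary `…ClockTransferGauges`).  With the forward dictionary: for `C²` profiles THE MEMBER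
LIOUVILLE STATEMENT (rung C1 / THE ONE STATEMENT's stratum) and THE PROFILE LIOUVILLE STATEMENT (Chae–Shvydkoy / CIV with exactly these three weights) are EQUIVALENT — the
crux's `C²` self-similar stratum is a statement about profile pairs alone; a refuter exhibits ONE pair `(V, P′)` + three numbers.
WHAT THIS IS NOT: not NS, not E — a dictionary lemma on the MODEL lattice (`--supports` stmt-19832); no profile is constructed here; 19832 OPEN.
[folklore; ConstantinIgnatovaVicol2026Putative §3.1.1 (3.2)–(3.3); CaffarelliKohnNirenberg1982 §2]
-/

noncomputable section

-- flat `Theorems/<Route><Decl>…` files of one crux share the namespace of the crux (tree convention: `Summit.<S>.<S>.…`)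
set_option linter.dupNamespace false

open MeasureTheory Set Filter Topology Metric Function TopologicalSpace
open scoped ENNReal NNReal

namespace Summit.NavierStokesRegularity.NavierStokesRegularity.Theorems.PowerGaugeEulerLiouville

open Literature.Analysis Literature.Analysis.FunctionSpaces Literature.Analysis.FluidPDE

namespace ProfileMember

variable {γ : ℝ} {V : EuclideanSpace ℝ (Fin 3) → EuclideanSpace ℝ (Fin 3)} {P : EuclideanSpace ℝ (Fin 3) → ℝ}

/-! ### The ansatz is jointly smooth below the blow-up time -/

/-- `(t, x) ↦ (−t)^{γ−1} • V((−t)^{−γ} x)` is `Cⁿ` on `(−∞,0) × ℝ³` when `V ∈ Cⁿ`. [folklore] -/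
theorem contDiffOn_uncurry_selfSimilarCollapse {n : ℕ∞} (hV : ContDiff ℝ n V) :
    ContDiffOn ℝ n (uncurry (selfSimilarCollapse γ 0 V)) (Iio (0 : ℝ) ×ˢ (univ : Set (EuclideanSpace ℝ (Fin 3)))) := by
  have hneg : ∀ z ∈ Iio (0 : ℝ) ×ˢ (univ : Set (EuclideanSpace ℝ (Fin 3))), (0 : ℝ) - z.1 ≠ 0 := by
    rintro ⟨t, x⟩ hz
    have : t < 0 := hz.1
    simp only; linarith
  have h1 : ContDiffOn ℝ n (fun z : ℝ × EuclideanSpace ℝ (Fin 3) => ((0 : ℝ) - z.1) ^ (γ - 1))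
      (Iio (0 : ℝ) ×ˢ (univ : Set (EuclideanSpace ℝ (Fin 3)))) :=
    (contDiffOn_const.sub contDiffOn_fst).rpow_const_of_ne hneg
  have h2 : ContDiffOn ℝ n (fun z : ℝ × EuclideanSpace ℝ (Fin 3) => ((0 : ℝ) - z.1) ^ (-γ))
      (Iio (0 : ℝ) ×ˢ (univ : Set (EuclideanSpace ℝ (Fin 3)))) :=
    (contDiffOn_const.sub contDiffOn_fst).rpow_const_of_ne hneg
  have h3 : ContDiffOn ℝ n (fun z : ℝ × EuclideanSpace ℝ (Fin 3) => V (((0 : ℝ) - z.1) ^ (-γ) • z.2))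
      (Iio (0 : ℝ) ×ˢ (univ : Set (EuclideanSpace ℝ (Fin 3)))) :=
    hV.comp_contDiffOn (h2.smul contDiffOn_snd)
  have e : uncurry (selfSimilarCollapse γ 0 V) =
      fun z : ℝ × EuclideanSpace ℝ (Fin 3) => ((0 : ℝ) - z.1) ^ (γ - 1) • V (((0 : ℝ) - z.1) ^ (-γ) • z.2) := by
    funext z; rfl
  rw [e]
  exact h1.smul h3

/-- `(t, x) ↦ (−t)^{2γ−2} P((−t)^{−γ} x)` is `Cⁿ` on `(−∞,0) × ℝ³` when `P ∈ Cⁿ`. [folklore] -/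
theorem contDiffOn_uncurry_selfSimilarCollapsePressure {n : ℕ∞} (hP : ContDiff ℝ n P) :
    ContDiffOn ℝ n (uncurry (selfSimilarCollapsePressure γ 0 P)) (Iio (0 : ℝ) ×ˢ (univ : Set (EuclideanSpace ℝ (Fin 3)))) := by
  have hneg : ∀ z ∈ Iio (0 : ℝ) ×ˢ (univ : Set (EuclideanSpace ℝ (Fin 3))), (0 : ℝ) - z.1 ≠ 0 := by
    rintro ⟨t, x⟩ hz
    have : t < 0 := hz.1
    simp only; linarith
  have h1 : ContDiffOn ℝ n (fun z : ℝ × EuclideanSpace ℝ (Fin 3) => ((0 : ℝ) - z.1) ^ (2 * (γ - 1)))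
      (Iio (0 : ℝ) ×ˢ (univ : Set (EuclideanSpace ℝ (Fin 3)))) :=
    (contDiffOn_const.sub contDiffOn_fst).rpow_const_of_ne hneg
  have h2 : ContDiffOn ℝ n (fun z : ℝ × EuclideanSpace ℝ (Fin 3) => ((0 : ℝ) - z.1) ^ (-γ))
      (Iio (0 : ℝ) ×ˢ (univ : Set (EuclideanSpace ℝ (Fin 3)))) :=
    (contDiffOn_const.sub contDiffOn_fst).rpow_const_of_ne hneg
  have h3 : ContDiffOn ℝ n (fun z : ℝ × EuclideanSpace ℝ (Fin 3) => P (((0 : ℝ) - z.1) ^ (-γ) • z.2))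
      (Iio (0 : ℝ) ×ˢ (univ : Set (EuclideanSpace ℝ (Fin 3)))) :=
    hP.comp_contDiffOn (h2.smul contDiffOn_snd)
  have e : uncurry (selfSimilarCollapsePressure γ 0 P) =
      fun z : ℝ × EuclideanSpace ℝ (Fin 3) => ((0 : ℝ) - z.1) ^ (2 * (γ - 1)) * P (((0 : ℝ) - z.1) ^ (-γ) • z.2) := by
    funext z; rfl
  rw [e]
  exact h1.mul h3

/-- The ansatz of a profile with `div V = 0` is divergence free on every slice `t < 0`. [folklore] -/
theorem isDivFree_selfSimilarCollapse (hdiv : VectorCalculus.IsDivFree V) {t : ℝ} (ht : t < 0) :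
    VectorCalculus.IsDivFree (selfSimilarCollapse γ 0 V t) := by
  intro x
  rw [VectorCalculus.divergence, fderiv_selfSimilarCollapse ht, ContinuousLinearMap.toLinearMap_smul, LinearMap.map_smul,
    smul_eq_mul]
  have := hdiv ((0 - t) ^ (-γ) • x)
  rw [VectorCalculus.divergence] at this
  rw [this, mul_zero]

/-! ### The ansatz of a CIV profile is a suitable weak Euler pair on the slab -/

/-- **THE ANSATZ OF A CIV PROFILE IS A SUITABLE WEAK EULER PAIR ON `(−∞,0) × ℝ³`** (`ν = 0`, `f = 0`): it is classical there (`V ∈ C²`, `P′ ∈ C¹`,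
`∂ₜu + (u·∇)u + ∇p = 0` by `IsSelfSimilarEulerProfile.euler_selfSimilarCollapse`, `div u = 0`), and classical solutions on an open slab are suitable weak
solutions there (CKN (2.1)–(2.5) with equality, tree `isSuitableWeakSolutionOn_of_contDiffOn`). [folklore] -/
theorem isSuitableWeakSolutionOn_selfSimilarCollapse (hprof : IsSelfSimilarEulerProfile γ 0 V P) :
    IsSuitableWeakSolutionOn (slab (EuclideanSpace ℝ (Fin 3)) (Iio 0) isOpen_Iio) 0 0
      (selfSimilarCollapse γ 0 V) (selfSimilarCollapsePressure γ 0 P) := by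
  refine isSuitableWeakSolutionOn_of_contDiffOn (S := Iio (0 : ℝ)) isOpen_Iio (by rw [coe_slab])
    (contDiffOn_uncurry_selfSimilarCollapse hprof.contDiff_velocity)
    (contDiffOn_uncurry_selfSimilarCollapsePressure hprof.contDiff_pressure)
    (by exact continuousOn_const) (fun t ht x => ?_) (fun t ht => isDivFree_selfSimilarCollapse hprof.divFree ht)
  have h := hprof.euler_selfSimilarCollapse (T := 0) (mem_Iio.1 ht) x
  rw [zero_smul, zero_sub]
  change timeDeriv (selfSimilarCollapse γ 0 V) t x + convect (selfSimilarCollapse γ 0 V t) (selfSimilarCollapse γ 0 V t) x =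
    -gradient (selfSimilarCollapsePressure γ 0 P t) x + 0
  rw [add_zero, eq_neg_iff_add_eq_zero]
  exact h

/-- **The classical gradient of the ansatz is a weak spatial gradient on the slab.** [folklore] -/
theorem hasWeakSpatialGradientOn_selfSimilarCollapse (hV : ContDiff ℝ 2 V) :
    HasWeakSpatialGradientOn (slab (EuclideanSpace ℝ (Fin 3)) (Iio 0) isOpen_Iio) (selfSimilarCollapse γ 0 V)
      fun t x => fderiv ℝ (selfSimilarCollapse γ 0 V t) x :=
  hasWeakSpatialGradientOn_of_contDiffOn (S := Iio (0 : ℝ)) isOpen_Iio (by rw [coe_slab])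
    (contDiffOn_uncurry_selfSimilarCollapse (hV.of_le (by norm_num)))

/-- The classical gradient of the ansatz is the self-similar gradient of `∇V` (`τ < 0`). [folklore] -/
theorem fderiv_selfSimilarCollapse_eq {τ : ℝ} (hτ : τ < 0) :
    (fun x => fderiv ℝ (selfSimilarCollapse γ 0 V τ) x) =
      fun x => (-τ) ^ (-1 : ℝ) • fderiv ℝ V ((-τ) ^ (-γ) • x) := by
  funext x
  rw [fderiv_selfSimilarCollapse hτ, zero_sub]

/-! ### Own-rate weights near the profile origin are free for `C²` / `C¹` profiles -/

/-- `∫_{B_1} |G|²_F ‖z‖^{ρ−1} < ∞` for CONTINUOUS `G` (`ρ < 1` irrelevant; `1 − ρ < 3` used). [folklore] -/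
theorem gradientWeight_near_ne_top {ρ : ℝ} (hρ : -2 < ρ)
    {G : EuclideanSpace ℝ (Fin 3) → EuclideanSpace ℝ (Fin 3) →L[ℝ] EuclideanSpace ℝ (Fin 3)} (hGc : Continuous G) :
    ∫⁻ z in ball (0 : EuclideanSpace ℝ (Fin 3)) 1,
      ENNReal.ofReal (frobeniusNormSq (G z)) * ENNReal.ofReal (‖z‖ ^ (ρ - 1)) ≠ ⊤ := by
  obtain ⟨B, hB⟩ : ∃ B, ∀ z ∈ closedBall (0 : EuclideanSpace ℝ (Fin 3)) 1, ‖frobeniusNormSq (G z)‖ ≤ B :=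
    (isCompact_closedBall 0 1).exists_bound_of_continuousOn
      ((SereginZajaczkowski2007.continuous_frobeniusNormSq.comp hGc).continuousOn)
  set f : EuclideanSpace ℝ (Fin 3) → ℝ := fun z => frobeniusNormSq (G z) * ‖z‖ ^ (ρ - 1) with hf
  have hint : IntegrableOn f (ball (0 : EuclideanSpace ℝ (Fin 3)) 1) volume := by
    refine integrableOn_ball_of_norm_le_rpow (μ := volume) (by rw [finrank_euclideanSpace_fin]; norm_num)
      (C := B) (α := 1 - ρ) (by rw [finrank_euclideanSpace_fin]; push_cast; linarith) ?_ ?_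
    · refine ae_restrict_of_forall_mem measurableSet_ball fun z hz => ?_
      have hfz : 0 ≤ frobeniusNormSq (G z) := frobeniusNormSq_nonneg _
      rw [hf]
      dsimp only
      rw [norm_mul, Real.norm_of_nonneg hfz, Real.norm_of_nonneg (Real.rpow_nonneg (norm_nonneg _) _), neg_sub]
      exact mul_le_mul_of_nonneg_right ((le_abs_self _).trans (hB z (ball_subset_closedBall hz)))
        (Real.rpow_nonneg (norm_nonneg _) _)
    · exact ((SereginZajaczkowski2007.continuous_frobeniusNormSq.comp hGc).measurable.mul
        (measurable_norm.pow_const _)).aestronglyMeasurable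
  have heq : ∀ z, ENNReal.ofReal (frobeniusNormSq (G z)) * ENNReal.ofReal (‖z‖ ^ (ρ - 1)) = ‖f z‖ₑ := by
    intro z
    have hfz : 0 ≤ frobeniusNormSq (G z) := frobeniusNormSq_nonneg _
    rw [hf]
    dsimp only
    rw [Real.enorm_eq_ofReal (mul_nonneg hfz (Real.rpow_nonneg (norm_nonneg _) _)), ENNReal.ofReal_mul hfz]
  simp_rw [heq]
  exact hint.2.ne

/-- `∫_{B_1} |Q|^{3/2} ‖z‖^{2ρ−2} < ∞` for CONTINUOUS `Q` (`−1/2 < ρ`). [folklore] -/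
theorem pressureWeight_near_ne_top {ρ : ℝ} (hρ : -1 / 2 < ρ) {Q : EuclideanSpace ℝ (Fin 3) → ℝ} (hQc : Continuous Q) :
    ∫⁻ z in ball (0 : EuclideanSpace ℝ (Fin 3)) 1, ‖Q z‖ₑ ^ (3 / 2 : ℝ) * ENNReal.ofReal (‖z‖ ^ (2 * ρ - 2)) ≠ ⊤ := by
  obtain ⟨B, hB⟩ : ∃ B, ∀ z ∈ closedBall (0 : EuclideanSpace ℝ (Fin 3)) 1, ‖Q z‖ ≤ B :=
    (isCompact_closedBall 0 1).exists_bound_of_continuousOn hQc.continuousOn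
  set f : EuclideanSpace ℝ (Fin 3) → ℝ := fun z => ‖Q z‖ ^ (3 / 2 : ℝ) * ‖z‖ ^ (2 * ρ - 2) with hf
  have hB0 : 0 ≤ B := (norm_nonneg _).trans (hB 0 (mem_closedBall_self zero_le_one))
  have hint : IntegrableOn f (ball (0 : EuclideanSpace ℝ (Fin 3)) 1) volume := by
    refine integrableOn_ball_of_norm_le_rpow (μ := volume) (by rw [finrank_euclideanSpace_fin]; norm_num)
      (C := B ^ (3 / 2 : ℝ)) (α := 2 - 2 * ρ) (by rw [finrank_euclideanSpace_fin]; push_cast; linarith) ?_ ?_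
    · refine ae_restrict_of_forall_mem measurableSet_ball fun z hz => ?_
      have h1 : 0 ≤ ‖Q z‖ ^ (3 / 2 : ℝ) := Real.rpow_nonneg (norm_nonneg _) _
      rw [hf]
      dsimp only
      rw [norm_mul, Real.norm_of_nonneg h1, Real.norm_of_nonneg (Real.rpow_nonneg (norm_nonneg _) _), neg_sub]
      exact mul_le_mul_of_nonneg_right (Real.rpow_le_rpow (norm_nonneg _) (hB z (ball_subset_closedBall hz)) (by norm_num))
        (Real.rpow_nonneg (norm_nonneg _) _)
    · exact ((hQc.measurable.norm.pow_const _).mul (measurable_norm.pow_const _)).aestronglyMeasurable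
  have heq : ∀ z, ‖Q z‖ₑ ^ (3 / 2 : ℝ) * ENNReal.ofReal (‖z‖ ^ (2 * ρ - 2)) = ‖f z‖ₑ := by
    intro z
    have h1 : 0 ≤ ‖Q z‖ ^ (3 / 2 : ℝ) := Real.rpow_nonneg (norm_nonneg _) _
    rw [hf]
    dsimp only
    rw [Real.enorm_eq_ofReal (mul_nonneg h1 (Real.rpow_nonneg (norm_nonneg _) _)), ENNReal.ofReal_mul h1, ← ofReal_norm,
      ENNReal.ofReal_rpow_of_nonneg (norm_nonneg _) (by norm_num)]
  simp_rw [heq]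
  exact hint.2.ne

/-! ### PROFILE ⇒ MEMBER -/

/-- **A `C²` CIV PROFILE PAIR WITH FINITE OWN-RATE WEIGHTS AT INFINITY IS AN EXACTLY SELF-SIMILAR CLASS MEMBER.**  Let `(V, P′)` satisfy CIV (3.3) on `ℝ³`
with exponent `γ = 1/(2+ρ)`, `−1/2 < ρ < 1`, and suppose (A∞) `∫_{B_L}‖V‖² ≤ N L^{1−2ρ}` for `L ≥ 1`, (E∞) `∫_{‖y‖≥1}|∇V|²_F ‖y‖^{ρ−1} < ∞`,
(D∞) `∫_{‖y‖≥1}|P′|^{3/2}‖y‖^{2ρ−2} < ∞`.  Then the ansatz `(selfSimilarCollapse γ 0 V, selfSimilarCollapsePressure γ 0 P′)` with its classical gradient is a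
member of Seregin's class with exponent `ρ`: suitable weak Euler pair + weak gradient on `(−∞,0) × ℝ³` and `a^{2ρ}A + a^{ρ}E + a^{2ρ}D ≤ c` at the origin for
EVERY `a > 0` (the class hypotheses of the crux verbatim; it is `IsExactlySelfSimilar ρ … V P′` by `rfl`). [folklore] -/
theorem exists_inClass_of_profile {ρ : ℝ} (hρ : -1 / 2 < ρ) (hρ1 : ρ < 1)
    (hprof : IsSelfSimilarEulerProfile (1 / (2 + ρ)) 0 V P) {N : ℝ≥0}
    (hA : ∀ L : ℝ, 1 ≤ L →
      ∫⁻ y in ball (0 : EuclideanSpace ℝ (Fin 3)) L, ‖V y‖ₑ ^ 2 ≤ (N : ℝ≥0∞) * ENNReal.ofReal (L ^ (1 - 2 * ρ)))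
    (hE : ∫⁻ y in {y : EuclideanSpace ℝ (Fin 3) | 1 ≤ ‖y‖},
      ENNReal.ofReal (frobeniusNormSq (fderiv ℝ V y)) * ENNReal.ofReal (‖y‖ ^ (ρ - 1)) ≠ ⊤)
    (hD : ∫⁻ y in {y : EuclideanSpace ℝ (Fin 3) | 1 ≤ ‖y‖}, ‖P y‖ₑ ^ (3 / 2 : ℝ) * ENNReal.ofReal (‖y‖ ^ (2 * ρ - 2)) ≠ ⊤) :
    ∃ c : ℝ≥0,
      IsSuitableWeakSolutionOn (slab (EuclideanSpace ℝ (Fin 3)) (Iio 0) isOpen_Iio) 0 0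
          (selfSimilarCollapse (1 / (2 + ρ)) 0 V) (selfSimilarCollapsePressure (1 / (2 + ρ)) 0 P) ∧
        HasWeakSpatialGradientOn (slab (EuclideanSpace ℝ (Fin 3)) (Iio 0) isOpen_Iio) (selfSimilarCollapse (1 / (2 + ρ)) 0 V)
          (fun t x => fderiv ℝ (selfSimilarCollapse (1 / (2 + ρ)) 0 V t) x) ∧
        ∀ a : ℝ, 0 < a →
          ENNReal.ofReal (a ^ (2 * ρ)) * cknA a (0 : ℝ × EuclideanSpace ℝ (Fin 3)) (selfSimilarCollapse (1 / (2 + ρ)) 0 V) +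
              ENNReal.ofReal (a ^ ρ) * cknE a (0 : ℝ × EuclideanSpace ℝ (Fin 3))
                (fun t x => fderiv ℝ (selfSimilarCollapse (1 / (2 + ρ)) 0 V t) x) +
            ENNReal.ofReal (a ^ (2 * ρ)) * cknD a (0 : ℝ × EuclideanSpace ℝ (Fin 3))
              (selfSimilarCollapsePressure (1 / (2 + ρ)) 0 P) ≤ (c : ℝ≥0∞) := by
  have hρ2 : 0 < 2 + ρ := by linarith
  set γ : ℝ := 1 / (2 + ρ) with hγ
  have hV : ContDiff ℝ 2 V := hprof.contDiff_velocity
  have hGc : Continuous (fderiv ℝ V) := hV.continuous_fderiv (by norm_num)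
  have hPc : Continuous P := hprof.contDiff_pressure.continuous
  set ut := selfSimilarCollapse γ 0 V with hut
  set pt := selfSimilarCollapsePressure γ 0 P with hpt
  set Ht : ℝ → EuclideanSpace ℝ (Fin 3) → EuclideanSpace ℝ (Fin 3) →L[ℝ] EuclideanSpace ℝ (Fin 3) :=
    fun t x => fderiv ℝ (ut t) x with hHt
  have hsw : IsSuitableWeakSolutionOn (slab (EuclideanSpace ℝ (Fin 3)) (Iio 0) isOpen_Iio) 0 0 ut pt :=
    isSuitableWeakSolutionOn_selfSimilarCollapse hprof
  have hH : HasWeakSpatialGradientOn (slab (EuclideanSpace ℝ (Fin 3)) (Iio 0) isOpen_Iio) ut Ht :=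
    hasWeakSpatialGradientOn_selfSimilarCollapse hV
  have hHpt : ∀ τ : ℝ, τ < 0 → Ht τ = fun x => (-τ) ^ (-1 : ℝ) • fderiv ℝ V ((-τ) ^ (-(1 / (2 + ρ))) • x) :=
    fun τ hτ => fderiv_selfSimilarCollapse_eq hτ
  -- ### (A): all scales (`L ≤ 1` from the continuity of `V`)
  obtain ⟨B, hB⟩ : ∃ B, ∀ y ∈ closedBall (0 : EuclideanSpace ℝ (Fin 3)) 1, ‖V y‖ ≤ B :=
    (isCompact_closedBall 0 1).exists_bound_of_continuousOn hV.continuous.continuousOn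
  set C : ℝ≥0∞ := ENNReal.ofReal (B ^ 2) * volume (ball (0 : EuclideanSpace ℝ (Fin 3)) 1) with hCdef
  have hC : C ≠ ⊤ := ENNReal.mul_ne_top ENNReal.ofReal_ne_top measure_ball_lt_top.ne
  have hNC : (N : ℝ≥0∞) + C ≠ ⊤ := ENNReal.add_ne_top.2 ⟨ENNReal.coe_ne_top, hC⟩
  have hN' : ∀ L : ℝ, 0 < L → ∫⁻ y in ball (0 : EuclideanSpace ℝ (Fin 3)) L, ‖V y‖ₑ ^ 2 ≤
      (((N : ℝ≥0∞) + C).toNNReal : ℝ≥0∞) * ENNReal.ofReal (L ^ (1 - 2 * ρ)) := by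
    intro L hL
    rw [ENNReal.coe_toNNReal hNC]
    by_cases hL1 : 1 ≤ L
    · exact (hA L hL1).trans (by gcongr; exact le_self_add)
    · have hL1' : L ≤ 1 := (not_le.1 hL1).le
      have hvol : volume (ball (0 : EuclideanSpace ℝ (Fin 3)) L) =
          ENNReal.ofReal (L ^ 3) * volume (ball (0 : EuclideanSpace ℝ (Fin 3)) 1) := by
        rw [Measure.addHaar_ball_of_pos volume 0 hL, finrank_euclideanSpace_fin]
      have hL3 : ENNReal.ofReal (L ^ 3) ≤ ENNReal.ofReal (L ^ (1 - 2 * ρ)) := by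
        refine ENNReal.ofReal_le_ofReal ?_
        rw [← Real.rpow_natCast]
        exact Real.rpow_le_rpow_of_exponent_ge hL hL1' (by push_cast; linarith)
      calc ∫⁻ y in ball (0 : EuclideanSpace ℝ (Fin 3)) L, ‖V y‖ₑ ^ 2
          ≤ ∫⁻ y in ball (0 : EuclideanSpace ℝ (Fin 3)) L, ENNReal.ofReal (B ^ 2) := by
            refine setLIntegral_mono' measurableSet_ball fun y hy => ?_
            have hy1 : y ∈ closedBall (0 : EuclideanSpace ℝ (Fin 3)) 1 :=
              closedBall_subset_closedBall hL1' (ball_subset_closedBall hy)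
            rw [← ofReal_norm, ← ENNReal.ofReal_pow (norm_nonneg _)]
            exact ENNReal.ofReal_le_ofReal (pow_le_pow_left₀ (norm_nonneg _) (hB y hy1) 2)
        _ = ENNReal.ofReal (B ^ 2) * (ENNReal.ofReal (L ^ 3) * volume (ball (0 : EuclideanSpace ℝ (Fin 3)) 1)) := by
            rw [setLIntegral_const, hvol]
        _ ≤ ENNReal.ofReal (B ^ 2) * (ENNReal.ofReal (L ^ (1 - 2 * ρ)) * volume (ball (0 : EuclideanSpace ℝ (Fin 3)) 1)) := by
            gcongr
        _ = C * ENNReal.ofReal (L ^ (1 - 2 * ρ)) := by rw [hCdef]; ring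
        _ ≤ ((N : ℝ≥0∞) + C) * ENNReal.ofReal (L ^ (1 - 2 * ρ)) := by gcongr; exact le_add_self
  have hAg := ClockTransfer.gaugeA_of_profile hρ2 (u := ut) (fun _ _ => rfl) hN'
  -- ### (E): near + far
  have hcompl : (ball (0 : EuclideanSpace ℝ (Fin 3)) 1)ᶜ ⊆ {z : EuclideanSpace ℝ (Fin 3) | 1 ≤ ‖z‖} := by
    intro z hz
    rw [mem_compl_iff, mem_ball_zero_iff, not_lt] at hz
    exact hz
  have hME : ∫⁻ z, ENNReal.ofReal (frobeniusNormSq (fderiv ℝ V z)) * ENNReal.ofReal (‖z‖ ^ (ρ - 1)) ≠ ⊤ := by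
    rw [← lintegral_add_compl _ measurableSet_ball]
    exact ENNReal.add_ne_top.2 ⟨gradientWeight_near_ne_top (by linarith) hGc,
      ne_top_of_le_ne_top hE (lintegral_mono_set hcompl)⟩
  have hHm : AEStronglyMeasurable (uncurry Ht) (volume.restrict (Iio (0 : ℝ) ×ˢ (univ : Set (EuclideanSpace ℝ (Fin 3))))) := by
    have := hH.locallyIntegrableOn_grad.aestronglyMeasurable
    rwa [coe_slab] at this
  have hEg := ClockTransfer.gaugeE_of_profile hρ2 hρ1 hGc.aestronglyMeasurable hHm hHpt (le_refl _)
  -- ### (D): near + far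
  have hMD : ∫⁻ z, ‖P z‖ₑ ^ (3 / 2 : ℝ) * ENNReal.ofReal (‖z‖ ^ (2 * ρ - 2)) ≠ ⊤ := by
    rw [← lintegral_add_compl _ measurableSet_ball]
    exact ENNReal.add_ne_top.2 ⟨pressureWeight_near_ne_top hρ hPc, ne_top_of_le_ne_top hD (lintegral_mono_set hcompl)⟩
  have hpm : AEStronglyMeasurable (uncurry pt) (volume.restrict (Iio (0 : ℝ) ×ˢ (univ : Set (EuclideanSpace ℝ (Fin 3))))) := by
    have := hsw.distributional.2.2.1.aestronglyMeasurable
    rwa [coe_slab] at this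
  have hDg := ClockTransfer.gaugeD_of_profile hρ2 hρ1 hPc.aestronglyMeasurable hpm (fun _ _ => rfl) (le_refl _)
  -- ### assemble
  set cE : ℝ≥0∞ := ENNReal.ofReal ((2 + ρ) / (1 - ρ)) *
    ∫⁻ z, ENNReal.ofReal (frobeniusNormSq (fderiv ℝ V z)) * ENNReal.ofReal (‖z‖ ^ (ρ - 1)) with hcE
  set cD : ℝ≥0∞ := ENNReal.ofReal ((2 + ρ) / (2 - 2 * ρ)) *
    ∫⁻ z, ‖P z‖ₑ ^ (3 / 2 : ℝ) * ENNReal.ofReal (‖z‖ ^ (2 * ρ - 2)) with hcD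
  have htot : (((N : ℝ≥0∞) + C).toNNReal : ℝ≥0∞) + cE + cD ≠ ⊤ :=
    ENNReal.add_ne_top.2 ⟨ENNReal.add_ne_top.2 ⟨ENNReal.coe_ne_top, ENNReal.mul_ne_top ENNReal.ofReal_ne_top hME⟩,
      ENNReal.mul_ne_top ENNReal.ofReal_ne_top hMD⟩
  refine ⟨((((N : ℝ≥0∞) + C).toNNReal : ℝ≥0∞) + cE + cD).toNNReal, hsw, hH, fun a ha => ?_⟩
  rw [ENNReal.coe_toNNReal htot]
  exact add_le_add (add_le_add (hAg a ha) (hEg a ha)) (hDg a ha)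

end ProfileMember

end Summit.NavierStokesRegularity.NavierStokesRegularity.Theorems.PowerGaugeEulerLiouville
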